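/-
Copyright (c) 2026 the pub-hodgecm-mathlib formalisation cell (harness21).  Prover seat hodgecm-mathlib-K2Liu-p09 (g6): Track B «K2-LIT»,
hLiu418 = stmt-HodgeConjecture-24832; LEAD F0P6-plan RULING M-158d «A7-val road (σ) null-cone multiplicity one», file V5 (generic half).
-/
import Summits.HodgeConjecture.HodgeConjecture.Theorems.K2LiuHomogeneousFunctionalLine   -- ★ V4 (K2E5-p16): the semi-invariant functionals of ONE orbit form a line
import Literature.Topology.CompactOpenDisjointRefinement                                -- ★ `isLocallyConstant_indicator_of_isClopen`, `hasCompactSupport_indicator_of_isCompact`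
import Mathlib.Topology.Algebra.Group.OpenMapping
import Mathlib.Topology.Baire.LocallyCompactRegular
import Mathlib.LinearAlgebra.Basis.VectorSpace
import HarnessLib

/-!
# Crux `HLiu418`, road `K2_Liu`, organ A7-val (road (σ)), file V5 (generic half): MULTIPLICITY ONE FOR FUNCTIONALS LIVING ON A NULL CONE
# — a closed `Γ`-stable set `N ∋ o` whose complement of the vertex is ONE `Γ`-orbit carries at most a LINE of `χ`-semi-invariant functionals, `χ ≠ 1`

Cell `hodgecm-mathlib`, crux item hLiu418 = `stmt-HodgeConjecture-24832`; squad K2 ∕ K2Liu; prover K2Liu-p09 (g6), organ lead A7-val.  THEOREMS ONLY (no `def`,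
no instance declaration, no notation, no named-fact hypothesis, no `sorry`); lane `--supports stmt-HodgeConjecture-24832` (count-neutral helper).  GENERIC topology:
no K2Liu letter is used here; the instance (`X = X_{Δ,B}`, `N` = the null cone of the Gram map, `Γ = GL(Δ) × U(V′_v)`, `o = 0`) is file V5-inst.
THE POINT (A7-val census `REPORT-FIRST-A7val-PaperFirst` (M3), non-split places).  `Γ` a totally disconnected σ-compact topological group with a compact open
subgroup `K₀`, `χ : Γ →* ℂ` trivial on `K₀` and NOT identically `1` (`χ γ₀ ≠ 1`); `X` a Hausdorff locally compact `Γ`-space with a vertex `o` fixed by `Γ` having a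
compact clopen neighbourhood; `N ⊆ X` closed, `Γ`-stable, `o ∈ N`, with `N ∖ {o}` ONE `Γ`-orbit; every locally constant compactly supported (lcc) function on `N ∖ {o}`
extends to an lcc function on `X` vanishing near `o` (★ V2c, K2Liu-p11).  THEN two linear functionals `T₁, T₂ : (X → ℂ) →ₗ ℂ` which on lcc functions are
`χ`-semi-invariant (`T(F ∘ (γ • ·)) = χ γ · T F`, ★ V4's convention) and vanish on lcc functions vanishing on `N` (★ V2 (N′): the `N_Δ`-invariance) are PROPORTIONAL
as soon as `T₁ ≠ 0`: **`∃ c, ∀ F lcc, T₂ F = c · T₁ F`**.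
* §1 `apply_eq_apply_vertex_mul_apply_indicator`, **`eq_zero_of_forall_eventually_eq_zero`** — the vertex lemma: a `χ`-semi-invariant `D` killing every lcc `F`
  that vanishes NEAR `o` kills every lcc `F` (`D F = F(o)·D(𝟙_M)` on a clopen compact `M ∋ o` where `F` is constant, and `D(𝟙_M) = χ γ₀ · D(𝟙_M)` through
  `M′ = M ∩ γ₀⁻¹M`) — this is how `δ_o` (the Siegel–Weil functional, law of `I(+½)`) is EXCLUDED from the `I(−½)`-line.
* §2 `eq_of_agree_off_vertex` — two lcc functions vanishing near `o` and agreeing on `N ∖ {o}` have the same `T`-value ((N′)).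
* §3 **`exists_forall_apply_eq_const_mul_of_nullCone`** — the theorem: the orbit `O = N ∖ {o}` is a locally compact Baire `Γ`-space with open orbit maps
  (`isOpenMap_smul_of_sigmaCompact`); `T_i` descend to `χ`-semi-invariant functionals `T♮_i` on the test functions of `O` (extension ★ V2c + §2 + `LinearMap.exists_extend`);
  ★ V4 `exists_forall_apply_eq_const_mul` gives `T♮₂ = c · T♮₁` unless `T♮₁ = 0`; `D := T₂ − c · T₁` (resp. `T₁`) then kills lcc functions vanishing near `o`, so §1 ends it.
HONEST LABEL.  `HC_CM` is proved only modulo the 7 printed citations (2 remaining named inputs: hLiu418 = `stmt-HodgeConjecture-24832`,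
h413 = `stmt-HodgeConjecture-24833`) until rung 0 closes.

## References
* [Rallis1984] S. Rallis, *On the Howe duality conjecture*, Compositio Math. 51 (1984) (invariant distributions on the null cone).
* [KudlaRallis1990] S. Kudla, S. Rallis, *Degenerate principal series and invariant distributions*, Israel J. Math. 69 (1990), §2–§3.
* [KudlaSweet1997] S. Kudla, W. J. Sweet, Israel J. Math. 98 (1997), §§2–4 (the unitary case).
* [BernsteinZelevinsky1976] I. N. Bernstein, A. V. Zelevinsky, Russian Math. Surveys 31 (1976), §1.1–1.5, §1.18 (l-spaces, distributions supported at a point).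
-/

set_option autoImplicit false
set_option linter.dupNamespace false -- the mandated namespace repeats `HodgeConjecture.HodgeConjecture`

noncomputable section

open Set Filter Topology MulAction Literature.Topology
open scoped Pointwise
open Summit.HodgeConjecture.HodgeConjecture.Cruxes.HLiu418.K2LiuHomogeneousFunctionalLine

namespace Summit.HodgeConjecture.HodgeConjecture.Cruxes.HLiu418.K2LiuNullConeMultiplicityOne

/-! ## §1 The vertex lemma: `χ ≠ 1` kills every functional supported at the vertex -/

section Vertex

variable {Γ : Type*} [Group Γ] {X : Type*} [TopologicalSpace X] [T2Space X] [MulAction Γ X]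

/-- `F − F(o)·𝟙_M` vanishes on `M` when `F` is constant on `M`; so a functional killing lcc functions vanishing near `o` has **`D F = F(o) · D(𝟙_M)`** for every
compact clopen `M ∋ o` on which `F` is constant. [cite: BernsteinZelevinsky1976, §1.3] -/
theorem apply_eq_apply_vertex_mul_apply_indicator (o : X) (D : (X → ℂ) →ₗ[ℂ] ℂ)
    (hD : ∀ F : X → ℂ, IsLocallyConstant F → HasCompactSupport F → (∀ᶠ x in 𝓝 o, F x = 0) → D F = 0)
    {F : X → ℂ} (hF : IsLocallyConstant F) (hFs : HasCompactSupport F) {M : Set X} (hM : IsClopen M) (hMc : IsCompact M) (hoM : o ∈ M)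
    (hFM : ∀ x ∈ M, F x = F o) : D F = F o * D (M.indicator fun _ => (1 : ℂ)) := by
  have hind : IsLocallyConstant (M.indicator fun _ => (1 : ℂ)) := isLocallyConstant_indicator_of_isClopen hM (IsLocallyConstant.const _)
  have hinds : HasCompactSupport (M.indicator fun _ => (1 : ℂ)) := hasCompactSupport_indicator_of_isCompact hMc _
  have hsmul : IsLocallyConstant (F o • M.indicator fun _ => (1 : ℂ)) := hind.comp fun c : ℂ => F o • c
  have hG : D (F - F o • M.indicator fun _ => (1 : ℂ)) = 0 := by
    refine hD _ (hF.comp₂ hsmul fun a b => a - b) (hFs.sub hinds.smul_left) ?_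
    filter_upwards [hM.isOpen.mem_nhds hoM] with x hx
    simp only [Pi.sub_apply, Pi.smul_apply, Set.indicator_of_mem hx, smul_eq_mul, mul_one, hFM x hx, sub_self]
  rw [map_sub, map_smul, smul_eq_mul, sub_eq_zero] at hG
  exact hG

/-- **THE VERTEX LEMMA.**  If `D` is `χ`-semi-invariant on lcc functions for a `Γ`-action fixing `o` (orbit maps continuous), `χ γ₀ ≠ 1` for some `γ₀`, `o` has a compact
clopen neighbourhood, and `D` kills every lcc function vanishing near `o`, then `D` kills EVERY lcc function — the functionals supported at the vertex are multiples of
`δ_o`, which is `Γ`-INVARIANT, hence not `χ`-semi-invariant. [cite: BernsteinZelevinsky1976, §1.18] [cite: KudlaRallis1990, §2] -/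
theorem eq_zero_of_forall_eventually_eq_zero (hcont : ∀ γ : Γ, Continuous fun x : X => γ • x) (o : X) (hfix : ∀ γ : Γ, γ • o = o)
    (hL : ∃ L : Set X, IsClopen L ∧ IsCompact L ∧ o ∈ L) (χ : Γ →* ℂ) (γ₀ : Γ) (hγ₀ : χ γ₀ ≠ 1) (D : (X → ℂ) →ₗ[ℂ] ℂ)
    (hDχ : ∀ F : X → ℂ, IsLocallyConstant F → HasCompactSupport F → ∀ γ : Γ, D (fun z => F (γ • z)) = χ γ * D F)
    (hD : ∀ F : X → ℂ, IsLocallyConstant F → HasCompactSupport F → (∀ᶠ x in 𝓝 o, F x = 0) → D F = 0)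
    {F : X → ℂ} (hF : IsLocallyConstant F) (hFs : HasCompactSupport F) : D F = 0 := by
  -- every compact clopen `M ∋ o` has `D(𝟙_M) = 0`
  have hcell : ∀ M : Set X, IsClopen M → IsCompact M → o ∈ M → D (M.indicator fun _ => (1 : ℂ)) = 0 := by
    intro M hM hMc hoM
    -- `M′ := M ∩ γ₀⁻¹M`
    have hM'cl : IsClopen (M ∩ (fun x => γ₀ • x) ⁻¹' M) := hM.inter (hM.preimage (hcont γ₀))
    have hM'c : IsCompact (M ∩ (fun x => γ₀ • x) ⁻¹' M) := hMc.of_isClosed_subset hM'cl.isClosed Set.inter_subset_left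
    have hoM' : o ∈ M ∩ (fun x => γ₀ • x) ⁻¹' M := ⟨hoM, by simpa only [Set.mem_preimage, hfix] using hoM⟩
    have hind : IsLocallyConstant (M.indicator fun _ => (1 : ℂ)) := isLocallyConstant_indicator_of_isClopen hM (IsLocallyConstant.const _)
    have hinds : HasCompactSupport (M.indicator fun _ => (1 : ℂ)) := hasCompactSupport_indicator_of_isCompact hMc _
    -- `𝟙_M` is `1` on `M′`
    have h1 : D (M.indicator fun _ => (1 : ℂ)) = D ((M ∩ (fun x => γ₀ • x) ⁻¹' M).indicator fun _ => (1 : ℂ)) := by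
      rw [apply_eq_apply_vertex_mul_apply_indicator o D hD hind hinds hM'cl hM'c hoM' fun x hx => by
        rw [Set.indicator_of_mem hx.1, Set.indicator_of_mem hoM], Set.indicator_of_mem hoM, one_mul]
    -- `𝟙_M ∘ (γ₀ • ·)` is lcc, is `1` on `M′` and at `o`
    have hG : IsLocallyConstant fun z => M.indicator (fun _ => (1 : ℂ)) (γ₀ • z) := hind.comp_continuous (hcont γ₀)
    have hGs : HasCompactSupport fun z => M.indicator (fun _ => (1 : ℂ)) (γ₀ • z) := by
      refine HasCompactSupport.intro ((hMc.image (hcont γ₀⁻¹)).of_isClosed_subset (hM.preimage (hcont γ₀)).isClosed fun x hx => ?_) fun x hx => ?_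
      · exact ⟨γ₀ • x, hx, by simp⟩
      · exact Set.indicator_of_notMem (show γ₀ • x ∉ M from hx) (fun _ => (1 : ℂ))
    have h2 : D (fun z => M.indicator (fun _ => (1 : ℂ)) (γ₀ • z)) = D ((M ∩ (fun x => γ₀ • x) ⁻¹' M).indicator fun _ => (1 : ℂ)) := by
      rw [apply_eq_apply_vertex_mul_apply_indicator o D hD hG hGs hM'cl hM'c hoM' fun x hx => by
        show M.indicator (fun _ => (1 : ℂ)) (γ₀ • x) = M.indicator (fun _ => (1 : ℂ)) (γ₀ • o)
        rw [Set.indicator_of_mem (show γ₀ • x ∈ M from hx.2), hfix, Set.indicator_of_mem hoM]]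
      rw [hfix, Set.indicator_of_mem hoM, one_mul]
    have h3 := hDχ _ hind hinds γ₀
    rw [h2, ← h1] at h3
    -- `D(𝟙_M) = χ γ₀ · D(𝟙_M)`
    have : (χ γ₀ - 1) * D (M.indicator fun _ => (1 : ℂ)) = 0 := by rw [sub_mul, one_mul, ← h3, sub_self]
    exact (mul_eq_zero.1 this).resolve_left (sub_ne_zero.2 hγ₀)
  -- `F` is constant on the compact clopen `L ∩ F⁻¹{F o}`
  obtain ⟨L, hL, hLc, hoL⟩ := hL
  have hMcl : IsClopen (L ∩ {x | F x = F o}) := hL.inter (hF.isClopen_fiber (F o))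
  have hMc : IsCompact (L ∩ {x | F x = F o}) := hLc.of_isClosed_subset hMcl.isClosed Set.inter_subset_left
  rw [apply_eq_apply_vertex_mul_apply_indicator o D hD hF hFs hMcl hMc ⟨hoL, rfl⟩ fun x hx => hx.2, hcell _ hMcl hMc ⟨hoL, rfl⟩, mul_zero]

end Vertex

/-! ## §2 (N′)-bookkeeping: values of `T` on functions vanishing near the vertex depend only on the restriction to `N ∖ {o}` -/

section Agree

variable {X : Type*} [TopologicalSpace X]

/-- two lcc functions vanishing near `o` and agreeing on `N ∖ {o}` have the same value under a functional killing lcc functions that vanish on `N`.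
[cite: BernsteinZelevinsky1976, §1.5] -/
theorem eq_of_agree_off_vertex (o : X) (N : Set X) (T : (X → ℂ) →ₗ[ℂ] ℂ)
    (hTN : ∀ F : X → ℂ, IsLocallyConstant F → HasCompactSupport F → (∀ x ∈ N, F x = 0) → T F = 0)
    {F F' : X → ℂ} (hF : IsLocallyConstant F) (hFs : HasCompactSupport F) (hF' : IsLocallyConstant F') (hF's : HasCompactSupport F')
    (hFo : ∀ᶠ x in 𝓝 o, F x = 0) (hF'o : ∀ᶠ x in 𝓝 o, F' x = 0) (hagree : ∀ x ∈ N, x ≠ o → F x = F' x) : T F = T F' := by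
  rw [← sub_eq_zero, ← map_sub]
  refine hTN _ (hF.comp₂ hF' fun a b => a - b) (hFs.sub hF's) fun x hx => ?_
  rcases eq_or_ne x o with rfl | hxo
  · rw [Pi.sub_apply, hFo.self_of_nhds, hF'o.self_of_nhds, sub_self]
  · rw [Pi.sub_apply, hagree x hx hxo, sub_self]

end Agree

/-! ## §3 Multiplicity one on the null cone -/

section Main

variable {Γ : Type*} [Group Γ] [TopologicalSpace Γ] [IsTopologicalGroup Γ] [TotallyDisconnectedSpace Γ] [SigmaCompactSpace Γ]
  {X : Type*} [TopologicalSpace X] [T2Space X] [LocallyCompactSpace X] [MulAction Γ X] [ContinuousSMul Γ X]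

omit [LocallyCompactSpace X] in
/-- **restriction to the orbit**: an lcc function on `X` vanishing near the vertex restricts to an lcc function on `N ∖ {o}`. [cite: BernsteinZelevinsky1976, §1.3] -/
theorem isLocallyConstant_hasCompactSupport_restrict (o : X) (N : Set X) (hNc : IsClosed N) {F : X → ℂ} (hF : IsLocallyConstant F) (hFs : HasCompactSupport F)
    (hFo : ∀ᶠ x in 𝓝 o, F x = 0) :
    IsLocallyConstant (fun x : ↥(N ∩ {x : X | x ≠ o}) => F x) ∧ HasCompactSupport (fun x : ↥(N ∩ {x : X | x ≠ o}) => F x) := by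
  refine ⟨hF.comp_continuous continuous_subtype_val, ?_⟩
  have ho : o ∉ tsupport F := notMem_tsupport_iff_eventuallyEq.2 hFo
  have hK : IsCompact ((Subtype.val : ↥(N ∩ {x : X | x ≠ o}) → X) ⁻¹' tsupport F) := by
    refine Subtype.isCompact_iff.2 ?_
    rw [Set.image_preimage_eq_inter_range, Subtype.range_coe]
    have hset : tsupport F ∩ (N ∩ {x : X | x ≠ o}) = tsupport F ∩ N := by
      ext x
      exact ⟨fun hx => ⟨hx.1, hx.2.1⟩, fun hx => ⟨hx.1, hx.2, fun hxo => ho (hxo ▸ hx.1)⟩⟩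
    rw [hset]
    exact hFs.inter_right hNc
  exact HasCompactSupport.intro hK fun x hx => image_eq_zero_of_notMem_tsupport hx

/-- **MULTIPLICITY ONE ON THE NULL CONE.**  `Γ` totally disconnected σ-compact with a compact open subgroup `K₀`, `χ : Γ →* ℂ` trivial on `K₀` with `χ γ₀ ≠ 1`; `X` a
Hausdorff locally compact `Γ`-space, `o` a vertex fixed by `Γ` with a compact clopen neighbourhood; `N ∋ o` closed and `Γ`-stable with `N ∖ {o}` ONE `Γ`-orbit; every lcc
function on `N ∖ {o}` extends to an lcc function on `X` vanishing near `o`.  If `T₁, T₂` are `χ`-semi-invariant on lcc functions and kill the lcc functions vanishing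
on `N`, and `T₁ ≠ 0`, then **`T₂ = c · T₁` on lcc functions**. [cite: Rallis1984] [cite: KudlaRallis1990, §2–§3] [cite: KudlaSweet1997, §§2–4] [cite: BernsteinZelevinsky1976, §1.18] -/
theorem exists_forall_apply_eq_const_mul_of_nullCone (K₀ : Subgroup Γ) (hK₀o : IsOpen (K₀ : Set Γ)) (hK₀c : IsCompact (K₀ : Set Γ))
    (χ : Γ →* ℂ) (hχ : ∀ k ∈ K₀, χ k = 1) (γ₀ : Γ) (hγ₀ : χ γ₀ ≠ 1)
    (o : X) (hfix : ∀ γ : Γ, γ • o = o) (hL : ∃ L : Set X, IsClopen L ∧ IsCompact L ∧ o ∈ L)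
    (N : Set X) (hNc : IsClosed N) (hNΓ : ∀ γ : Γ, ∀ x ∈ N, γ • x ∈ N)
    (htrans : ∀ x ∈ N, ∀ y ∈ N, x ≠ o → y ≠ o → ∃ γ : Γ, γ • x = y)
    (hext : ∀ f : ↥(N ∩ {x : X | x ≠ o}) → ℂ, IsLocallyConstant f → HasCompactSupport f →
      ∃ F : X → ℂ, IsLocallyConstant F ∧ HasCompactSupport F ∧ (∀ᶠ x in 𝓝 o, F x = 0) ∧ ∀ x : ↥(N ∩ {x : X | x ≠ o}), F x = f x)
    (T₁ T₂ : (X → ℂ) →ₗ[ℂ] ℂ)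
    (hT₁ : ∀ F : X → ℂ, IsLocallyConstant F → HasCompactSupport F → ∀ γ : Γ, T₁ (fun z => F (γ • z)) = χ γ * T₁ F)
    (hT₂ : ∀ F : X → ℂ, IsLocallyConstant F → HasCompactSupport F → ∀ γ : Γ, T₂ (fun z => F (γ • z)) = χ γ * T₂ F)
    (hT₁N : ∀ F : X → ℂ, IsLocallyConstant F → HasCompactSupport F → (∀ x ∈ N, F x = 0) → T₁ F = 0)
    (hT₂N : ∀ F : X → ℂ, IsLocallyConstant F → HasCompactSupport F → (∀ x ∈ N, F x = 0) → T₂ F = 0)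
    {F₀ : X → ℂ} (hF₀ : IsLocallyConstant F₀) (hF₀s : HasCompactSupport F₀) (hne : T₁ F₀ ≠ 0) :
    ∃ c : ℂ, ∀ F : X → ℂ, IsLocallyConstant F → HasCompactSupport F → T₂ F = c * T₁ F := by
  classical
  have hcontX : ∀ γ : Γ, Continuous fun x : X => γ • x := fun γ => continuous_const_smul γ
  -- the orbit `O = N ∖ {o}` as a `Γ`-space
  letI : MulAction Γ ↥(N ∩ {x : X | x ≠ o}) :=
    { smul := fun γ x => ⟨γ • (x : X), hNΓ γ x x.2.1, fun h => x.2.2 (by rw [← inv_smul_smul γ (x : X), (h : γ • (x : X) = o), hfix])⟩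
      one_smul := fun x => Subtype.ext (one_smul Γ (x : X))
      mul_smul := fun a b x => Subtype.ext (mul_smul a b (x : X)) }
  have hcoe : ∀ (γ : Γ) (x : ↥(N ∩ {x : X | x ≠ o})), (((γ • x : ↥(N ∩ {x : X | x ≠ o})) : X)) = γ • (x : X) := fun _ _ => rfl
  haveI : ContinuousSMul Γ ↥(N ∩ {x : X | x ≠ o}) :=
    ⟨(continuous_smul.comp (continuous_fst.prodMk (continuous_subtype_val.comp continuous_snd))).subtype_mk _⟩
  haveI : LocallyCompactSpace ↥(N ∩ {x : X | x ≠ o}) := (hNc.isLocallyClosed.inter isOpen_ne.isLocallyClosed).locallyCompactSpace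
  haveI : IsPretransitive Γ ↥(N ∩ {x : X | x ≠ o}) :=
    ⟨fun x y => by obtain ⟨γ, hγ⟩ := htrans x x.2.1 y y.2.1 x.2.2 y.2.2; exact ⟨γ, Subtype.ext hγ⟩⟩
  have hopen : ∀ x : ↥(N ∩ {x : X | x ≠ o}), IsOpenMap fun γ : Γ => γ • x := fun x => isOpenMap_smul_of_sigmaCompact x
  -- DESCENT: every `T` killing the lcc functions vanishing on `N` descends to the test functions of the orbit
  have descend : ∀ T : (X → ℂ) →ₗ[ℂ] ℂ, (∀ F : X → ℂ, IsLocallyConstant F → HasCompactSupport F → (∀ x ∈ N, F x = 0) → T F = 0) →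
      ∃ Td : (↥(N ∩ {x : X | x ≠ o}) → ℂ) →ₗ[ℂ] ℂ, ∀ F : X → ℂ, IsLocallyConstant F → HasCompactSupport F → (∀ᶠ x in 𝓝 o, F x = 0) →
        Td (fun x => F x) = T F := by
    intro T hTN
    choose ext hext1 hext2 hext3 hext4 using hext
    have indep : ∀ {F F' : X → ℂ}, IsLocallyConstant F → HasCompactSupport F → IsLocallyConstant F' → HasCompactSupport F' →
        (∀ᶠ x in 𝓝 o, F x = 0) → (∀ᶠ x in 𝓝 o, F' x = 0) → (∀ x : ↥(N ∩ {x : X | x ≠ o}), F x = F' x) → T F = T F' :=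
      fun hF hFs hF' hF's hFo hF'o hag => eq_of_agree_off_vertex o N T hTN hF hFs hF' hF's hFo hF'o fun x hx hxo => hag ⟨x, hx, hxo⟩
    -- the lcc submodule of the orbit and the functional on it
    let S : Submodule ℂ (↥(N ∩ {x : X | x ≠ o}) → ℂ) :=
      { carrier := {f | IsLocallyConstant f ∧ HasCompactSupport f}
        add_mem' := fun {f g} hf hg => ⟨hf.1.comp₂ hg.1 fun a b => a + b, hf.2.add hg.2⟩
        zero_mem' := ⟨IsLocallyConstant.const 0, HasCompactSupport.intro isCompact_empty fun _ _ => rfl⟩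
        smul_mem' := fun c f hf => ⟨hf.1.comp fun z => c • z, hf.2.smul_left⟩ }
    have hSmem : ∀ {f : ↥(N ∩ {x : X | x ≠ o}) → ℂ}, f ∈ S ↔ IsLocallyConstant f ∧ HasCompactSupport f := fun {f} => Iff.rfl
    let t : S →ₗ[ℂ] ℂ :=
      { toFun := fun f => T (ext f.1 f.2.1 f.2.2)
        map_add' := fun f g => by
          show T (ext (f.1 + g.1) (S.add_mem f.2 g.2).1 (S.add_mem f.2 g.2).2) = T (ext f.1 f.2.1 f.2.2) + T (ext g.1 g.2.1 g.2.2)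
          rw [← map_add]
          refine indep (hext1 _ _ _) (hext2 _ _ _) ((hext1 _ _ _).comp₂ (hext1 _ _ _) fun a b => a + b) ((hext2 _ _ _).add (hext2 _ _ _))
            (hext3 _ _ _) ((hext3 _ _ _).and (hext3 _ _ _) |>.mono fun x hx => by rw [Pi.add_apply, hx.1, hx.2, add_zero]) fun x => ?_
          rw [hext4, Pi.add_apply, Pi.add_apply, hext4, hext4]
        map_smul' := fun c f => by
          show T (ext (c • f.1) (S.smul_mem c f.2).1 (S.smul_mem c f.2).2) = c • T (ext f.1 f.2.1 f.2.2)
          rw [← map_smul]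
          refine indep (hext1 _ _ _) (hext2 _ _ _) ((hext1 _ _ _).comp fun z => c • z) (hext2 _ _ _).smul_left (hext3 _ _ _)
            ((hext3 _ _ _).mono fun x hx => by rw [Pi.smul_apply, hx, smul_zero]) fun x => ?_
          rw [hext4, Pi.smul_apply, Pi.smul_apply, hext4] }
    obtain ⟨Td, hTd⟩ := LinearMap.exists_extend t
    refine ⟨Td, fun F hF hFs hFo => ?_⟩
    have hres := isLocallyConstant_hasCompactSupport_restrict o N hNc hF hFs hFo
    have h1 : Td (fun x => F x) = t ⟨fun x => F x, hres⟩ := by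
      rw [← hTd]; rfl
    rw [h1]
    show T (ext (fun x : ↥(N ∩ {x : X | x ≠ o}) => F x) hres.1 hres.2) = T F
    exact indep (hext1 _ _ _) (hext2 _ _ _) hF hFs (hext3 _ _ _) hFo fun x => hext4 _ _ _ x
  obtain ⟨Td₁, hTd₁⟩ := descend T₁ hT₁N
  obtain ⟨Td₂, hTd₂⟩ := descend T₂ hT₂N
  -- the descended functionals are `χ`-semi-invariant on the test functions of the orbit
  have hsemi : ∀ (T : (X → ℂ) →ₗ[ℂ] ℂ) (Td : (↥(N ∩ {x : X | x ≠ o}) → ℂ) →ₗ[ℂ] ℂ),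
      (∀ F : X → ℂ, IsLocallyConstant F → HasCompactSupport F → ∀ γ : Γ, T (fun z => F (γ • z)) = χ γ * T F) →
      (∀ F : X → ℂ, IsLocallyConstant F → HasCompactSupport F → (∀ᶠ x in 𝓝 o, F x = 0) → Td (fun x => F x) = T F) →
      ∀ f : ↥(N ∩ {x : X | x ≠ o}) → ℂ, IsLocallyConstant f → HasCompactSupport f → ∀ γ : Γ, Td (fun z => f (γ • z)) = χ γ * Td f := by
    intro T Td hT hTd f hf hfs γ
    obtain ⟨F, hF, hFs, hFo, hFf⟩ := hext f hf hfs
    have hG : IsLocallyConstant fun z : X => F (γ • z) := hF.comp_continuous (hcontX γ)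
    have hGs : HasCompactSupport fun z : X => F (γ • z) := hFs.comp_homeomorph (Homeomorph.smul γ)
    have hGo : ∀ᶠ z in 𝓝 o, F (γ • z) = 0 := by
      have ht : Tendsto (fun z : X => γ • z) (𝓝 o) (𝓝 o) := by simpa only [hfix] using ((hcontX γ).tendsto o)
      exact ht.eventually hFo
    have hf' : (fun z : ↥(N ∩ {x : X | x ≠ o}) => f (γ • z)) = fun z => F ((γ • z : ↥(N ∩ {x : X | x ≠ o})) : X) := funext fun z => (hFf _).symm
    have hf0 : f = fun z : ↥(N ∩ {x : X | x ≠ o}) => F z := funext fun z => (hFf z).symm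
    rw [hf', hf0, hTd F hF hFs hFo]
    simp only [hcoe]
    rw [hTd _ hG hGs hGo, hT F hF hFs γ]
  have hs₁ := hsemi T₁ Td₁ hT₁ hTd₁
  have hs₂ := hsemi T₂ Td₂ hT₂ hTd₂
  -- either `Td₁ ≠ 0` (then ★ V4 gives the constant) or `T₁` is supported at the vertex (then §1 kills it)
  by_cases h0 : ∃ f₀ : ↥(N ∩ {x : X | x ≠ o}) → ℂ, IsLocallyConstant f₀ ∧ HasCompactSupport f₀ ∧ Td₁ f₀ ≠ 0
  · obtain ⟨f₀, hf₀, hf₀s, hf₀ne⟩ := h0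
    obtain ⟨c, hc⟩ := exists_forall_apply_eq_const_mul K₀ hK₀o hK₀c hopen χ hχ Td₁ Td₂ hs₁ hs₂ hf₀ hf₀s hf₀ne
    refine ⟨c, fun F hF hFs => ?_⟩
    -- `D := T₂ − c·T₁` kills the lcc functions vanishing near `o`, hence everything (§1)
    have hD : ∀ G : X → ℂ, IsLocallyConstant G → HasCompactSupport G → (∀ᶠ x in 𝓝 o, G x = 0) → (T₂ - c • T₁) G = 0 := by
      intro G hG hGs hGo
      have hres := isLocallyConstant_hasCompactSupport_restrict o N hNc hG hGs hGo
      rw [LinearMap.sub_apply, LinearMap.smul_apply, ← hTd₁ G hG hGs hGo, ← hTd₂ G hG hGs hGo, hc _ hres.1 hres.2, smul_eq_mul, sub_self]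
    have hDχ : ∀ G : X → ℂ, IsLocallyConstant G → HasCompactSupport G → ∀ γ : Γ, (T₂ - c • T₁) (fun z => G (γ • z)) = χ γ * (T₂ - c • T₁) G := by
      intro G hG hGs γ
      simp only [LinearMap.sub_apply, LinearMap.smul_apply, hT₁ G hG hGs γ, hT₂ G hG hGs γ, smul_eq_mul]
      ring
    have h := eq_zero_of_forall_eventually_eq_zero hcontX o hfix hL χ γ₀ hγ₀ (T₂ - c • T₁) hDχ hD hF hFs
    rw [LinearMap.sub_apply, LinearMap.smul_apply, smul_eq_mul, sub_eq_zero] at h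
    exact h
  · exfalso
    push Not at h0
    have hD : ∀ G : X → ℂ, IsLocallyConstant G → HasCompactSupport G → (∀ᶠ x in 𝓝 o, G x = 0) → T₁ G = 0 := by
      intro G hG hGs hGo
      have hres := isLocallyConstant_hasCompactSupport_restrict o N hNc hG hGs hGo
      rw [← hTd₁ G hG hGs hGo]
      exact h0 _ hres.1 hres.2
    exact hne (eq_zero_of_forall_eventually_eq_zero hcontX o hfix hL χ γ₀ hγ₀ T₁ hT₁ hD hF₀ hF₀s)

end Main

end Summit.HodgeConjecture.HodgeConjecture.Cruxes.HLiu418.K2LiuNullConeMultiplicityOne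

end
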